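import Mathlib
import Summits.AnomalousDissipation.AnomalousDissipation.Theorems.LimitingAbsorptionFloorUpgradeStubCosTransformNonneg
import HarnessLib

/-!
# The abstract zero-frequency floor assembled from its parts (stub A4)

Crux `LimitingAbsorption.FloorUpgrade` (stmt-AnomalousDissipation-15010), line `SketchIdeator1`,
stub `stub_zeroFrequencyFloor_of_parts`: elementary assembly of the zero-frequency floor
`∫₀^∞ C ≥ C(0)/(8Λ)` from the nonnegativity, the sum rule and the tail estimate of the cosine
transform `ρ(ξ) = ∫₀^∞ C(τ) cos(ξτ) dτ` (stubs A1–A3, consumed here as hypotheses).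

Route (with `M = C 0`, `p = ∫₀^∞ C`):
* Taylor-free bound `ρ(ξ) ≤ p + A ξ² / γ³` from `1 - x²/2 ≤ cos x`, `|C| ≤ A e^{-γ|τ|}` and
  Euler's integral `∫₀^∞ τ² e^{-γτ} dτ = 2/γ³`;
* mass near zero `∫_{[-L,L]} ρ ≤ 2Lp + (2A/(3γ³)) L³`;
* tail `∫_{[-L,L]ᶜ} ρ ≤ ∫_{2 ≤ |uξ|} ρ ≤ (π/u) ∫_{-u}^{u} (M - C) ≤ 2π (δu + MΛ²u²/2)`, `u = 2/L`;
* split `πM = ∫ ρ` at `L = 4Λ` (`u = 1/(2Λ)`), and use `γ³ ≥ 64 (A/M) Λ³` (the cube of the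
  fast-regime hypothesis), `δ ≤ MΛ/6` and `π > 3`: `8Λp ≥ (7π/12 - 2/3) M ≥ 13M/12`.
-/

set_option linter.dupNamespace false

noncomputable section

open MeasureTheory Set Filter Topology
open scoped BigOperators

namespace Summit.AnomalousDissipation.AnomalousDissipation.Theorems.FloorUpgradeLine

namespace ZeroFrequencyFloor

/-- Euler's integral with `Γ(3) = 2`: `∫₀^∞ τ² e^{-γτ} dτ = 2/γ³` for `γ > 0`. [folklore] -/
theorem integral_sq_mul_exp_neg_mul {γ : ℝ} (hγ : 0 < γ) :
    ∫ τ in Ioi (0 : ℝ), τ ^ 2 * Real.exp (-(γ * τ)) = 2 / γ ^ 3 := by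
  have h := Real.integral_rpow_mul_exp_neg_mul_Ioi (a := 3) (r := γ) three_pos hγ
  have h3 : Real.Gamma 3 = 2 := by norm_num [Nat.factorial]
  have h4 : ∫ τ in Ioi (0 : ℝ), τ ^ 2 * Real.exp (-(γ * τ)) =
      ∫ t in Ioi (0 : ℝ), t ^ ((3 : ℝ) - 1) * Real.exp (-(γ * t)) := by
    refine setIntegral_congr_fun measurableSet_Ioi (fun t _ => ?_)
    norm_num
  rw [h4, h, h3, show (3 : ℝ) = ((3 : ℕ) : ℝ) by norm_num, Real.rpow_natCast]
  field_simp

/-- `τ ↦ τ² e^{-γτ}` is integrable on `(0, ∞)` for `γ > 0` (its integral is the nonzero number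
`2/γ³`). [folklore] -/
theorem integrableOn_sq_mul_exp_neg_mul {γ : ℝ} (hγ : 0 < γ) :
    IntegrableOn (fun τ : ℝ => τ ^ 2 * Real.exp (-(γ * τ))) (Ioi 0) := by
  refine Integrable.of_integral_ne_zero ?_
  rw [integral_sq_mul_exp_neg_mul hγ]
  positivity

/-- For an integrable `C`, `τ ↦ C τ cos(ξτ)` is integrable. [folklore] -/
theorem integrable_mul_cos (C : ℝ → ℝ) (hCi : Integrable C) (ξ : ℝ) :
    Integrable (fun τ => C τ * Real.cos (ξ * τ)) := by
  refine hCi.mul_bdd (c := 1) (Continuous.aestronglyMeasurable (by fun_prop))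
    (ae_of_all _ fun τ => ?_)
  rw [Real.norm_eq_abs]
  exact Real.abs_cos_le_one _

/-- **Taylor-free bound.** If `|C τ| ≤ A e^{-γ|τ|}` then
`∫₀^∞ C(τ) cos(ξτ) dτ ≤ ∫₀^∞ C + A ξ²/γ³`: indeed
`C cos(ξτ) - C = -C (1 - cos(ξτ)) ≤ |C| (1 - cos(ξτ)) ≤ A e^{-γτ} ξ²τ²/2`, and
`∫₀^∞ τ² e^{-γτ} = 2/γ³`. [folklore] -/
theorem cosTransform_le (C : ℝ → ℝ) (A γ : ℝ) (hC : Continuous C) (hγ : 0 < γ)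
    (hA : ∀ τ, |C τ| ≤ A * Real.exp (-(γ * |τ|))) (ξ : ℝ) :
    ∫ τ in Ioi (0 : ℝ), C τ * Real.cos (ξ * τ) ≤
      (∫ τ in Ioi (0 : ℝ), C τ) + A * ξ ^ 2 / γ ^ 3 := by
  have hCi : Integrable C := CosTransformNonneg.integrable_of_abs_le_exp C A γ hC hγ hA
  have h1 : IntegrableOn (fun τ => C τ * Real.cos (ξ * τ)) (Ioi 0) :=
    (integrable_mul_cos C hCi ξ).integrableOn
  have h2 : IntegrableOn (fun τ : ℝ => A * ξ ^ 2 / 2 * (τ ^ 2 * Real.exp (-(γ * τ)))) (Ioi 0) :=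
    Integrable.const_mul (integrableOn_sq_mul_exp_neg_mul hγ) _
  have hsub : (∫ τ in Ioi (0 : ℝ), C τ * Real.cos (ξ * τ)) - (∫ τ in Ioi (0 : ℝ), C τ) =
      ∫ τ in Ioi (0 : ℝ), (C τ * Real.cos (ξ * τ) - C τ) :=
    (integral_sub h1 hCi.integrableOn).symm
  have hle : ∫ τ in Ioi (0 : ℝ), (C τ * Real.cos (ξ * τ) - C τ) ≤
      ∫ τ in Ioi (0 : ℝ), A * ξ ^ 2 / 2 * (τ ^ 2 * Real.exp (-(γ * τ))) := by
    refine setIntegral_mono_on (h1.sub hCi.integrableOn) h2 measurableSet_Ioi (fun τ hτ => ?_)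
    have hτ0 : 0 < τ := hτ
    have hAτ : |C τ| ≤ A * Real.exp (-(γ * τ)) := by
      have h := hA τ
      rwa [abs_of_pos hτ0] at h
    have hexp : 0 ≤ A * Real.exp (-(γ * τ)) := (abs_nonneg _).trans hAτ
    have hcos1 : Real.cos (ξ * τ) ≤ 1 := Real.cos_le_one _
    have hcos2 : 1 - (ξ * τ) ^ 2 / 2 ≤ Real.cos (ξ * τ) := Real.one_sub_sq_div_two_le_cos
    calc C τ * Real.cos (ξ * τ) - C τ = -C τ * (1 - Real.cos (ξ * τ)) := by ring
      _ ≤ |C τ| * (1 - Real.cos (ξ * τ)) :=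
          mul_le_mul_of_nonneg_right (neg_le_abs (C τ)) (by linarith)
      _ ≤ A * Real.exp (-(γ * τ)) * (1 - Real.cos (ξ * τ)) :=
          mul_le_mul_of_nonneg_right hAτ (by linarith)
      _ ≤ A * Real.exp (-(γ * τ)) * ((ξ * τ) ^ 2 / 2) :=
          mul_le_mul_of_nonneg_left (by linarith) hexp
      _ = A * ξ ^ 2 / 2 * (τ ^ 2 * Real.exp (-(γ * τ))) := by ring
  have hval : ∫ τ in Ioi (0 : ℝ), A * ξ ^ 2 / 2 * (τ ^ 2 * Real.exp (-(γ * τ))) =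
      A * ξ ^ 2 / γ ^ 3 := by
    rw [integral_const_mul, integral_sq_mul_exp_neg_mul hγ]
    field_simp
  linarith

/-- **Mass near zero.** If `ρ ≤ p + B ξ²` pointwise and `ρ` is integrable then
`∫_{[-L,L]} ρ ≤ 2Lp + 2BL³/3` (`L ≥ 0`). [folklore] -/
theorem integral_Icc_le (ρ : ℝ → ℝ) (p B L : ℝ) (hL : 0 ≤ L) (hρi : Integrable ρ)
    (hρ : ∀ ξ, ρ ξ ≤ p + B * ξ ^ 2) :
    ∫ ξ in Icc (-L) L, ρ ξ ≤ 2 * L * p + 2 * B * L ^ 3 / 3 := by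
  have hcont : Continuous fun ξ : ℝ => p + B * ξ ^ 2 := by fun_prop
  calc ∫ ξ in Icc (-L) L, ρ ξ ≤ ∫ ξ in Icc (-L) L, (p + B * ξ ^ 2) :=
        setIntegral_mono hρi.integrableOn hcont.integrableOn_Icc fun ξ => hρ ξ
    _ = ∫ ξ in (-L)..L, (p + B * ξ ^ 2) := by
        rw [intervalIntegral.integral_of_le (by linarith), integral_Icc_eq_integral_Ioc]
    _ = 2 * L * p + 2 * B * L ^ 3 / 3 := by
        rw [intervalIntegral.integral_add (Continuous.intervalIntegrable (by fun_prop) _ _)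
            (Continuous.intervalIntegrable (by fun_prop) _ _),
          intervalIntegral.integral_const, intervalIntegral.integral_const_mul, integral_pow]
        simp only [smul_eq_mul]
        norm_num
        ring

/-- Outside `[-2/u, 2/u]` one has `2 ≤ |u ξ|` (`u > 0`). [folklore] -/
theorem compl_Icc_subset {u : ℝ} (hu : 0 < u) :
    (Icc (-(2 / u)) (2 / u))ᶜ ⊆ {ξ : ℝ | 2 ≤ |u * ξ|} := by
  intro ξ hξ
  rw [mem_compl_iff, mem_Icc, not_and_or, not_le, not_le] at hξ
  rw [mem_setOf_eq, abs_mul, abs_of_pos hu]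
  have h2 : 2 / u < |ξ| := by
    rcases hξ with h | h
    · have h' : 2 / u < -ξ := by linarith
      exact h'.trans_le (neg_le_abs ξ)
    · exact h.trans_le (le_abs_self ξ)
  rw [div_lt_iff₀ hu] at h2
  linarith

/-- **Tail estimate.** For `ρ ≥ 0` integrable with the inversion tail bound
`∫_{2 ≤ |uξ|} ρ ≤ (π/u) ∫_{-u}^{u} (M - C)` and the cusp-tolerant quadratic bound
`M - C τ ≤ δ|τ| + MΛ²τ²/2`, one has `∫_{[-2/u,2/u]ᶜ} ρ ≤ 2π (δu + MΛ²u²/2)`. [folklore] -/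
theorem tail_le (C ρ : ℝ → ℝ) (M Λ δ u : ℝ) (hC : Continuous C) (hu : 0 < u) (hδ : 0 ≤ δ)
    (hM : 0 ≤ M) (hρnonneg : ∀ ξ, 0 ≤ ρ ξ) (hρint : Integrable ρ)
    (hquad : ∀ τ, M - C τ ≤ δ * |τ| + M * Λ ^ 2 * τ ^ 2 / 2)
    (htail : ∫ ξ in {ξ : ℝ | 2 ≤ |u * ξ|}, ρ ξ ≤ Real.pi / u * ∫ τ in -u..u, (M - C τ)) :
    ∫ ξ in (Icc (-(2 / u)) (2 / u))ᶜ, ρ ξ ≤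
      2 * Real.pi * (δ * u + M * Λ ^ 2 * u ^ 2 / 2) := by
  have h1 : ∫ ξ in (Icc (-(2 / u)) (2 / u))ᶜ, ρ ξ ≤ ∫ ξ in {ξ : ℝ | 2 ≤ |u * ξ|}, ρ ξ :=
    setIntegral_mono_set hρint.integrableOn (ae_of_all _ fun ξ => hρnonneg ξ)
      (compl_Icc_subset hu).eventuallyLE
  have hpt : ∀ τ ∈ Icc (-u) u, M - C τ ≤ δ * u + M * Λ ^ 2 * u ^ 2 / 2 := by
    intro τ hτ
    have hτabs : |τ| ≤ u := abs_le.2 ⟨hτ.1, hτ.2⟩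
    have hτsq : τ ^ 2 ≤ u ^ 2 := sq_le_sq' hτ.1 hτ.2
    have hMΛ : 0 ≤ M * Λ ^ 2 := by positivity
    have h3 : δ * |τ| ≤ δ * u := mul_le_mul_of_nonneg_left hτabs hδ
    have h4 : M * Λ ^ 2 * τ ^ 2 ≤ M * Λ ^ 2 * u ^ 2 := mul_le_mul_of_nonneg_left hτsq hMΛ
    linarith [hquad τ]
  have h2 : ∫ τ in -u..u, (M - C τ) ≤ 2 * u * (δ * u + M * Λ ^ 2 * u ^ 2 / 2) := by
    have h : ∫ τ in -u..u, (M - C τ) ≤ ∫ _ in -u..u, (δ * u + M * Λ ^ 2 * u ^ 2 / 2) :=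
      intervalIntegral.integral_mono_on (by linarith) (Continuous.intervalIntegrable (by fun_prop) _ _)
        (Continuous.intervalIntegrable (by fun_prop) _ _) hpt
    rwa [intervalIntegral.integral_const, smul_eq_mul, show u - -u = 2 * u by ring] at h
  calc ∫ ξ in (Icc (-(2 / u)) (2 / u))ᶜ, ρ ξ ≤ ∫ ξ in {ξ : ℝ | 2 ≤ |u * ξ|}, ρ ξ := h1
    _ ≤ Real.pi / u * ∫ τ in -u..u, (M - C τ) := htail
    _ ≤ Real.pi / u * (2 * u * (δ * u + M * Λ ^ 2 * u ^ 2 / 2)) :=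
        mul_le_mul_of_nonneg_left h2 (by positivity)
    _ = 2 * Real.pi * (δ * u + M * Λ ^ 2 * u ^ 2 / 2) := by
        field_simp

/-- Cubing the fast-regime hypothesis: `4 (A/M)^{1/3} Λ ≤ γ` with `0 < M ≤ A` gives
`64 A Λ³ ≤ M γ³`. [folklore] -/
theorem cube_fast {A M Λ γ : ℝ} (hM : 0 < M) (hMA : M ≤ A) (hΛ : 0 < Λ)
    (hfast : 4 * (A / M) ^ ((1 : ℝ) / 3) * Λ ≤ γ) : 64 * A * Λ ^ 3 ≤ M * γ ^ 3 := by
  have hAM : 0 ≤ A / M := div_nonneg (hM.le.trans hMA) hM.le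
  have ht0 : 0 ≤ (A / M) ^ ((1 : ℝ) / 3) := Real.rpow_nonneg hAM _
  have ht3 : ((A / M) ^ ((1 : ℝ) / 3)) ^ 3 = A / M := by
    have h := Real.rpow_inv_natCast_pow (n := 3) hAM three_ne_zero
    rw [one_div]
    exact_mod_cast h
  have h4 : 0 ≤ 4 * (A / M) ^ ((1 : ℝ) / 3) * Λ := by positivity
  have h5 : (4 * (A / M) ^ ((1 : ℝ) / 3) * Λ) ^ 3 ≤ γ ^ 3 := pow_le_pow_left₀ h4 hfast 3
  have h6 : (4 * (A / M) ^ ((1 : ℝ) / 3) * Λ) ^ 3 = 64 * A * Λ ^ 3 / M := by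
    rw [mul_pow, mul_pow, ht3]
    ring
  rw [h6, div_le_iff₀ hM] at h5
  linarith

/-- **Final arithmetic.** From the split `I₁ + I₂ = πM`, the near bound
`I₁ ≤ 8Λp + 2M/3` and the tail bound `I₂ ≤ πM/6 + πM/4`, with `π > 3`:
`8Λp ≥ (7π/12 - 2/3) M ≥ 13M/12 ≥ M`. [folklore] -/
theorem floor_arith {M Λ p I₁ I₂ : ℝ} (hΛ : 0 < Λ) (hM : 0 < M)
    (hsplit : I₁ + I₂ = Real.pi * M) (h1 : I₁ ≤ 8 * Λ * p + 2 * M / 3)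
    (h2 : I₂ ≤ Real.pi * M / 6 + Real.pi * M / 4) : M / (8 * Λ) ≤ p := by
  rw [div_le_iff₀ (by positivity)]
  have hπ : 3 * M ≤ Real.pi * M := mul_le_mul_of_nonneg_right Real.pi_gt_three.le hM.le
  nlinarith

/-- **The abstract floor.** For `ρ ≥ 0` integrable with `∫ ρ = πM`, `ρ ξ ≤ p + Aξ²/γ³`, the
inversion tail bound and the cusp-tolerant quadratic bound on `M - C`, in the fast regime
`4 (A/M)^{1/3} Λ ≤ γ` with `δ ≤ MΛ/6`: `M/(8Λ) ≤ p`. [folklore] -/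
theorem floor_abstract (C ρ : ℝ → ℝ) (p A γ Λ δ : ℝ) (hC : Continuous C)
    (hγ : 0 < γ) (hΛ : 0 < Λ) {M : ℝ} (hM : 0 < M) (hMA : M ≤ A) (hδ : 0 ≤ δ)
    (hδΛ : δ ≤ M * Λ / 6)
    (hfast : 4 * (A / M) ^ ((1 : ℝ) / 3) * Λ ≤ γ)
    (hquad : ∀ τ, M - C τ ≤ δ * |τ| + M * Λ ^ 2 * τ ^ 2 / 2)
    (hnonneg : ∀ ξ, 0 ≤ ρ ξ) (hint : Integrable ρ) (hsum : ∫ ξ, ρ ξ = Real.pi * M)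
    (htail : ∀ u : ℝ, 0 < u →
        ∫ ξ in {ξ : ℝ | 2 ≤ |u * ξ|}, ρ ξ ≤ Real.pi / u * ∫ τ in -u..u, (M - C τ))
    (hle : ∀ ξ, ρ ξ ≤ p + A * ξ ^ 2 / γ ^ 3) :
    M / (8 * Λ) ≤ p := by
  have hle' : ∀ ξ, ρ ξ ≤ p + A / γ ^ 3 * ξ ^ 2 := fun ξ => by
    have h := hle ξ
    calc ρ ξ ≤ p + A * ξ ^ 2 / γ ^ 3 := h
      _ = p + A / γ ^ 3 * ξ ^ 2 := by ring
  have hu : (0 : ℝ) < 1 / (2 * Λ) := by positivity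
  have hL : 2 / (1 / (2 * Λ)) = 4 * Λ := by
    field_simp
    ring
  -- near-zero mass
  have hnear : ∫ ξ in Icc (-(4 * Λ)) (4 * Λ), ρ ξ ≤
      2 * (4 * Λ) * p + 2 * (A / γ ^ 3) * (4 * Λ) ^ 3 / 3 :=
    integral_Icc_le ρ p (A / γ ^ 3) (4 * Λ) (by positivity) hint hle'
  -- tail
  have htl : ∫ ξ in (Icc (-(2 / (1 / (2 * Λ)))) (2 / (1 / (2 * Λ))))ᶜ, ρ ξ ≤
      2 * Real.pi * (δ * (1 / (2 * Λ)) + M * Λ ^ 2 * (1 / (2 * Λ)) ^ 2 / 2) :=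
    tail_le C ρ M Λ δ (1 / (2 * Λ)) hC hu hδ hM.le hnonneg hint hquad (htail _ hu)
  rw [hL] at htl
  -- split
  have hsplit := integral_add_compl
    (measurableSet_Icc : MeasurableSet (Icc (-(4 * Λ)) (4 * Λ))) hint
  rw [hsum] at hsplit
  -- numeric bounds
  have hcube : 64 * A * Λ ^ 3 ≤ M * γ ^ 3 := cube_fast hM hMA hΛ hfast
  have hγ3 : 0 < γ ^ 3 := pow_pos hγ 3
  have hkey : 64 * (A / γ ^ 3) * Λ ^ 3 ≤ M := by
    rw [show 64 * (A / γ ^ 3) * Λ ^ 3 = 64 * A * Λ ^ 3 / γ ^ 3 by ring, div_le_iff₀ hγ3]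
    linarith
  have h1 : 2 * (4 * Λ) * p + 2 * (A / γ ^ 3) * (4 * Λ) ^ 3 / 3 ≤ 8 * Λ * p + 2 * M / 3 := by
    nlinarith
  have hδ' : δ * (1 / (2 * Λ)) ≤ M / 12 := by
    rw [mul_one_div, div_le_iff₀ (by positivity)]
    linarith
  have hsq : M * Λ ^ 2 * (1 / (2 * Λ)) ^ 2 / 2 = M / 8 := by
    field_simp
    ring
  have h2 : 2 * Real.pi * (δ * (1 / (2 * Λ)) + M * Λ ^ 2 * (1 / (2 * Λ)) ^ 2 / 2) ≤
      Real.pi * M / 6 + Real.pi * M / 4 := by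
    rw [hsq]
    have h := mul_le_mul_of_nonneg_left hδ' Real.pi_pos.le
    nlinarith
  exact floor_arith hΛ hM hsplit (hnear.trans h1) (htl.trans h2)

end ZeroFrequencyFloor

open ZeroFrequencyFloor in
/-- **A4.** The abstract zero-frequency floor from its parts: for a continuous `C` with
`|C(τ)| ≤ A e^{-γ|τ|}`, `C(0) - C(τ) ≤ δ|τ| + C(0)Λ²τ²/2`, in the fast regime
`γ ≥ 4 (A/C(0))^{1/3} Λ` with a small cusp `δ ≤ C(0)Λ/6`, and whose cosine transform
`ρ(ξ) = ∫₀^∞ C(τ) cos(ξτ) dτ` is nonnegative, integrable with `∫ ρ = π C(0)` and satisfies the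
inversion tail bound `∫_{2 ≤ |uξ|} ρ ≤ (π/u) ∫_{-u}^{u} (C(0) - C)`, the zero-frequency integral
is floored: `∫₀^∞ C ≥ C(0)/(8Λ)`. Proof: `ρ(ξ) ≤ ρ(0) + Aξ²/γ³` (Taylor-free bound), split
`∫ ρ` at `|ξ| = 4Λ`, tail with `u = 1/(2Λ)`, `π > 3`. [folklore] -/
theorem stub_zeroFrequencyFloor_of_parts (C : ℝ → ℝ) (A γ Λ δ : ℝ) (hC : Continuous C)
    (hγ : 0 < γ) (hΛ : 0 < Λ) (hM : 0 < C 0) (hMA : C 0 ≤ A) (hδ : 0 ≤ δ)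
    (hδΛ : δ ≤ C 0 * Λ / 6)
    (hfast : 4 * (A / C 0) ^ ((1 : ℝ) / 3) * Λ ≤ γ)
    (_heven : ∀ τ, C (-τ) = C τ)
    (hA : ∀ τ, |C τ| ≤ A * Real.exp (-(γ * |τ|)))
    (hquad : ∀ τ, C 0 - C τ ≤ δ * |τ| + C 0 * Λ ^ 2 * τ ^ 2 / 2)
    (hnonneg : ∀ ξ : ℝ, 0 ≤ ∫ τ in Ioi (0 : ℝ), C τ * Real.cos (ξ * τ))
    (hint : Integrable (fun ξ : ℝ => ∫ τ in Ioi (0 : ℝ), C τ * Real.cos (ξ * τ)))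
    (hsum : ∫ ξ, (∫ τ in Ioi (0 : ℝ), C τ * Real.cos (ξ * τ)) = Real.pi * C 0)
    (htail : ∀ u : ℝ, 0 < u →
        ∫ ξ in {ξ : ℝ | 2 ≤ |u * ξ|}, (∫ σ in Ioi (0 : ℝ), C σ * Real.cos (ξ * σ)) ≤
          Real.pi / u * ∫ τ in -u..u, (C 0 - C τ)) :
    C 0 / (8 * Λ) ≤ ∫ τ in Ioi (0 : ℝ), C τ :=
  floor_abstract C (fun ξ => ∫ τ in Ioi (0 : ℝ), C τ * Real.cos (ξ * τ))
    (∫ τ in Ioi (0 : ℝ), C τ) A γ Λ δ hC hγ hΛ hM hMA hδ hδΛ hfast hquad hnonneg hint hsum htail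
    (cosTransform_le C A γ hC hγ hA)

end Summit.AnomalousDissipation.AnomalousDissipation.Theorems.FloorUpgradeLine

end
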